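import Summits.AtomisticToContinuum.BoseEinsteinCondensation.Theorems.BoxCountShadowB
import HarnessLib

/-!
# BoxCountShadow — PART C (§4–§5) of lens-6 g35 `BoxCountShadow.lean` (sha256 11126a30378dce1a), split at section boundaries for the
# 400-line rule by hand-2 g11 at landing; declaration bodies byte-identical, same namespace `…Theorems.BoxCountShadow`.
-/


open MeasureTheory Filter Set
open scoped ENNReal NNReal BigOperators

namespace Summit.AtomisticToContinuum.BoseEinsteinCondensation.Theorems.BoxCountShadow

open Literature.MathematicalPhysics.QuantumManyBody.BoseGas
open Summit.AtomisticToContinuum.BoseEinsteinCondensation.Theorems.BoxLatticeFSum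
open Summit.AtomisticToContinuum.BoseEinsteinCondensation.Theorems.BoxLabelAffinity
open Summit.AtomisticToContinuum.BoseEinsteinCondensation.Theorems.BoxHorizonAffinity

variable {n : ℕ}

/-! ### §4  The pieces -/

/-- **NUM_h(η)** (crux · DECLARED RESIDUAL of gen 35 · TAG WEAKER than LAB_h(η) (`horizonCountAffinity_of_horizonLabelAffinity`)
· UNDECIDED-COUNT · TRUE-type · NECESSARY for flat-mode BEC (`occupation_flat_le_countAffinity`) · leaf IDEA-NEEDED)
`GroundStateHorizonCountAffinity η`: for `a > 0` there is `M₀ > 0` such that for every horizon constant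
`M ≥ M₀` there are `c > 0` and a density cap below which, eventually in `N`, the nonnegative ground state
(when one exists) has COUNT AFFINITY `≥ c` for every block number `K` of the horizon window
`L/K ∈ [Mρ^{-η}/√ρ, 2Mρ^{-η}/√ρ]`.  A statement about the LAW OF `K³` OCCUPATION NUMBERS of `|Ψ₀|²` ONLY
(`p_N ∈ Prob(ℕ^{K³})`): INSERTION TOLERANCE of the count law — the conditional law of the inserted particle's
block given only the counts of the others, `r(B|m) ∝ p_N(m + e_B)(m_B + 1)`, is Hellinger-comparable to
uniform on `P̄`-average.  Its negation is NUMBER RIGIDITY of the `|Ψ₀|²` point process at the horizon scale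
(parity / commensuration locking of cell counts), which is invisible to every energy functional at precision
`o(N/L²)` (Josephson scale; tree route `NumberFilterBlindness`) — so NUM_h lies OUTSIDE the energy class, as a
residual of this lens must.  At the Gaussian (structure-factor) level its defect is
`≍ ρ⁻¹∫_0^{1/ℓ_h} k² S(k)⁻¹ dk → 0` in `d = 3` already under the kinetic floor `S(k) ≳ k²`, so the whole
content is NON-Gaussian (arithmetic) regularity of `p_N`; nearest printed tools: canonical-ensemble tolerance /
non-rigidity criteria for point processes [GhoshPeres2017; DOI 10.1002/cpa.21963] and ultra-log-concavity of
counts under strong Rayleigh measures — none available for `|Ψ₀|²` of interacting bosons.  Why it might fail: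
only through an arithmetic lock of horizon counts in the true ground state, which positivity of `Ψ₀` excludes
qualitatively but nothing in print excludes quantitatively.
[cite: GhoshPeres2017, DOI 10.1215/00127094-2017-0002 (rigidity–tolerance dichotomy); LSSY2005, Thm 7.1 (BEC in the GP box ⇒ NUM there, by `occupation_flat_le_countAffinity`)] -/
@[conjecture] def GroundStateHorizonCountAffinity (η : ℝ≥0) : Prop :=
  ∀ v : ℝ → ℝ≥0∞, IsRepulsiveFiniteRange v → 0 < scatteringLength v →
    ∃ M₀ : ℝ, 0 < M₀ ∧ ∀ M : ℝ, M₀ ≤ M → ∃ c : ℝ, 0 < c ∧ ∃ ρ₀ : ℝ, 0 < ρ₀ ∧ ∀ ρ : ℝ, 0 < ρ → ρ < ρ₀ →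
      ∀ᶠ n : ℕ in atTop,
        (∃ Ψ₀ : Config (n + 1) → ℝ, (∀ X, 0 ≤ Ψ₀ X) ∧
          IsGroundState v (sideLength ρ (n + 1)) (fun X => (Ψ₀ X : ℂ))) →
        ∀ K : ℕ, 0 < K → InWindow (M * ρ ^ (-(η : ℝ))) ρ (sideLength ρ (n + 1)) K →
          ENNReal.ofReal c ≤
            countAffinity (sideLength ρ (n + 1)) K (groundState v (n + 1) (sideLength ρ (n + 1)))

/-- **SUF_h(η)** (crux · TAG WEAKER-OR-EQUAL than LAB_h(η) (`horizonCountSufficiency_of_horizonLabelAffinity`)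
· UNDECIDED-LOCAL · leaf ATTACKABLE·conditional (natural sufficient condition: fibrewise closeness of the label
law given `Y` to the label law given `m(Y)`, a within-horizon-block decorrelation statement))
`GroundStateHorizonCountSufficiency η`: for `a > 0` there is `M₀ > 0` such that for every `M ≥ M₀` there are
`s > 0` and a density cap below which, eventually in `N`, the nonnegative ground state has
`labelAffinity ≥ s · countAffinity` for every `K` of the horizon window: COUNT SUFFICIENCY — the geometry of the
environment beyond its horizon-cell counts improves the localisation of particle 1's block by at most the
factor `s` in Bhattacharyya terms.  Holds with `s = 1` in the number-locked (Mott) model state where LAB_h and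
NUM_h both fail, so it is STRICTLY weaker than LAB_h and independent of NUM_h; fails in cross-block bound-pair
model states with tolerant counts (where NUM_h holds), so it is not implied by NUM_h.  Why it might fail: a
loosely bound cross-block pair structure in `|Ψ₀|²` (energy cost `≪` LHY precision) would let the partner's
position, not the counts, reveal the block.
[cite: LSSY2005, Thm 7.1 (flat-mode BEC ⇒ LAB ⇒ SUF with `s = c`, by `countAffinity_le_one`)] -/
@[conjecture] def GroundStateHorizonCountSufficiency (η : ℝ≥0) : Prop :=
  ∀ v : ℝ → ℝ≥0∞, IsRepulsiveFiniteRange v → 0 < scatteringLength v →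
    ∃ M₀ : ℝ, 0 < M₀ ∧ ∀ M : ℝ, M₀ ≤ M → ∃ s : ℝ, 0 < s ∧ ∃ ρ₀ : ℝ, 0 < ρ₀ ∧ ∀ ρ : ℝ, 0 < ρ → ρ < ρ₀ →
      ∀ᶠ n : ℕ in atTop,
        (∃ Ψ₀ : Config (n + 1) → ℝ, (∀ X, 0 ≤ Ψ₀ X) ∧
          IsGroundState v (sideLength ρ (n + 1)) (fun X => (Ψ₀ X : ℂ))) →
        ∀ K : ℕ, 0 < K → InWindow (M * ρ ^ (-(η : ℝ))) ρ (sideLength ρ (n + 1)) K →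
          ENNReal.ofReal s *
              countAffinity (sideLength ρ (n + 1)) K (groundState v (n + 1) (sideLength ρ (n + 1))) ≤
            labelAffinity (sideLength ρ (n + 1)) K (groundState v (n + 1) (sideLength ρ (n + 1)))

/-! ### §5  The kernels: LAB_h ⟺ NUM_h ∧ SUF_h, and the deciding kernel -/

/-- **NUM_h ∧ SUF_h ⟹ LAB_h** (take `M = max M₀ M₀'`, constant `s·c`). [folklore] -/
theorem horizonLabelAffinity_of_count (η : ℝ≥0) (hnum : GroundStateHorizonCountAffinity η)
    (hsuf : GroundStateHorizonCountSufficiency η) : GroundStateHorizonLabelAffinity η := by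
  intro v hv ha
  obtain ⟨M₁, hM₁, hnum'⟩ := hnum v hv ha
  obtain ⟨M₂, hM₂, hsuf'⟩ := hsuf v hv ha
  obtain ⟨c, hc, ρ₁, hρ₁, hc'⟩ := hnum' (max M₁ M₂) (le_max_left _ _)
  obtain ⟨s, hs, ρ₂, hρ₂, hs'⟩ := hsuf' (max M₁ M₂) (le_max_right _ _)
  refine ⟨s * c, mul_pos hs hc, max M₁ M₂, lt_max_of_lt_left hM₁, min ρ₁ ρ₂, lt_min hρ₁ hρ₂,
    fun ρ hρ hρlt => ?_⟩
  have h1 : ρ < ρ₁ := hρlt.trans_le (min_le_left _ _)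
  have h2 : ρ < ρ₂ := hρlt.trans_le (min_le_right _ _)
  filter_upwards [hc' ρ hρ h1, hs' ρ hρ h2] with n hcn hsn hex K hK hKw
  calc ENNReal.ofReal (s * c) = ENNReal.ofReal s * ENNReal.ofReal c := ENNReal.ofReal_mul hs.le
    _ ≤ ENNReal.ofReal s *
          countAffinity (sideLength ρ (n + 1)) K (groundState v (n + 1) (sideLength ρ (n + 1))) :=
        mul_le_mul' le_rfl (hcn hex K hK hKw)
    _ ≤ labelAffinity (sideLength ρ (n + 1)) K (groundState v (n + 1) (sideLength ρ (n + 1))) :=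
        hsn hex K hK hKw

/-- LAB_h at its window gives LAB `≥ c` at every COARSER horizon window (refine into the original window with
`exists_mul_inWindow`, then refinement monotonicity `labelAffinity_mul_le`). [folklore] -/
theorem labelAffinity_ge_coarser {η : ℝ≥0} {v : ℝ → ℝ≥0∞} {c M M' ρ : ℝ} (hM : 0 < M) (hMM' : M ≤ M')
    (hρ : 0 < ρ) {n : ℕ}
    (h : ∀ K : ℕ, 0 < K → InWindow (M * ρ ^ (-(η : ℝ))) ρ (sideLength ρ (n + 1)) K →
      ENNReal.ofReal c ≤
        labelAffinity (sideLength ρ (n + 1)) K (groundState v (n + 1) (sideLength ρ (n + 1))))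
    {K : ℕ} (hK : 0 < K) (hKw : InWindow (M' * ρ ^ (-(η : ℝ))) ρ (sideLength ρ (n + 1)) K) :
    ENNReal.ofReal c ≤
      labelAffinity (sideLength ρ (n + 1)) K (groundState v (n + 1) (sideLength ρ (n + 1))) := by
  have hA : 0 < M * ρ ^ (-(η : ℝ)) := mul_pos hM (Real.rpow_pos_of_pos hρ _)
  have hAA' : M * ρ ^ (-(η : ℝ)) ≤ M' * ρ ^ (-(η : ℝ)) :=
    mul_le_mul_of_nonneg_right hMM' (Real.rpow_pos_of_pos hρ _).le
  obtain ⟨j, hj, hjw⟩ := exists_mul_inWindow hA hAA' hρ hK hKw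
  have hL : 0 < sideLength ρ (n + 1) := sideLength_pos_of_inWindow hA hρ (Nat.mul_pos hK hj) hjw
  exact (h (K * j) (Nat.mul_pos hK hj) hjw).trans
    (labelAffinity_mul_le hL hK hj (measurable_groundState v (n + 1) _))

/-- **LAB_h ⟹ NUM_h** — the gen-35 residual is WEAKER than the gen-34 residual (`labelAffinity_le_countAffinity`
at every sufficiently coarse horizon window). [folklore] -/
theorem horizonCountAffinity_of_horizonLabelAffinity (η : ℝ≥0) (hlab : GroundStateHorizonLabelAffinity η) :
    GroundStateHorizonCountAffinity η := by
  intro v hv ha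
  obtain ⟨c, hc, M, hM, ρ₀, hρ₀, h⟩ := hlab v hv ha
  refine ⟨M, hM, fun M' hMM' => ⟨c, hc, ρ₀, hρ₀, fun ρ hρ hρlt => ?_⟩⟩
  filter_upwards [h ρ hρ hρlt] with n hn hex K hK hKw
  exact (labelAffinity_ge_coarser hM hMM' hρ (hn hex) hK hKw).trans
    (labelAffinity_le_countAffinity _ K (measurable_groundState v (n + 1) _))

/-- **LAB_h ⟹ SUF_h** with `s = c` (`countAffinity ≤ 1` for the normalised ground state). [folklore] -/
theorem horizonCountSufficiency_of_horizonLabelAffinity (η : ℝ≥0)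
    (hlab : GroundStateHorizonLabelAffinity η) : GroundStateHorizonCountSufficiency η := by
  intro v hv ha
  obtain ⟨c, hc, M, hM, ρ₀, hρ₀, h⟩ := hlab v hv ha
  refine ⟨M, hM, fun M' hMM' => ⟨c, hc, ρ₀, hρ₀, fun ρ hρ hρlt => ?_⟩⟩
  filter_upwards [h ρ hρ hρlt] with n hn hex K hK hKw
  have hA : 0 < M' * ρ ^ (-(η : ℝ)) := mul_pos (hM.trans_le hMM') (Real.rpow_pos_of_pos hρ _)
  set L := sideLength ρ (n + 1) with hLdef
  have hL : 0 < L := sideLength_pos_of_inWindow hA hρ hK hKw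
  set Φ := groundState v (n + 1) L with hΦdef
  have hΦm : Measurable Φ := measurable_groundState v (n + 1) L
  have hΦ1 : ∫⁻ Y : Config n, ∫⁻ x, ENNReal.ofReal (Φ (Matrix.vecCons x Y)) ^ 2 = 1 := by
    rw [← lintegral_eq_lintegral_lintegral_vecCons (hΦm.ennreal_ofReal.pow_const 2)]
    exact lintegral_groundState_sq hex
  calc ENNReal.ofReal c * countAffinity L K Φ ≤ ENNReal.ofReal c * 1 :=
        mul_le_mul' le_rfl (countAffinity_le_one hL hK hΦm hΦ1)
    _ = ENNReal.ofReal c := mul_one _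
    _ ≤ labelAffinity L K Φ := labelAffinity_ge_coarser hM hMM' hρ (hn hex) hK hKw

/-- **EXACTNESS OF THE CARVING**: LAB_h(η) ⟺ NUM_h(η) ∧ SUF_h(η). [folklore] -/
theorem horizonLabelAffinity_iff_count (η : ℝ≥0) :
    GroundStateHorizonLabelAffinity η ↔
      GroundStateHorizonCountAffinity η ∧ GroundStateHorizonCountSufficiency η :=
  ⟨fun h => ⟨horizonCountAffinity_of_horizonLabelAffinity η h,
    horizonCountSufficiency_of_horizonLabelAffinity η h⟩,
    fun h => horizonLabelAffinity_of_count η h.1 h.2⟩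

/-- **DECIDING KERNEL OF GEN 35** (0 sorry; hypotheses = the pieces only):
UGS → LOC_h(η) → NUM_h(η) → SUF_h(η) → `BoseEinsteinCondensation`, for every `η`. [folklore] -/
theorem bec_of_countPieces₀ (η : ℝ≥0) (hU : BoxGroundStateUniqueness)
    (hloc : GroundStateHorizonCondensation η) (hnum : GroundStateHorizonCountAffinity η)
    (hsuf : GroundStateHorizonCountSufficiency η) : _root_.BoseEinsteinCondensation :=
  bec_of_horizonAffinity₀ η hU hloc (horizonLabelAffinity_of_count η hnum hsuf)

/-- **THE GEN-35 NODE assembled down to the energy-class leaves** (0 sorry):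
UGS → LOC → TSD(η) → NUM_h(η) → SUF_h(η) → `BoseEinsteinCondensation`. [folklore] -/
theorem bec_of_twoScaleCount₀ (η : ℝ≥0) (hU : BoxGroundStateUniqueness)
    (hloc : GroundStateBlockCondensation) (htsd : GroundStateTwoScaleDepletion η)
    (hnum : GroundStateHorizonCountAffinity η) (hsuf : GroundStateHorizonCountSufficiency η) :
    _root_.BoseEinsteinCondensation :=
  bec_of_countPieces₀ η hU (horizonCondensation_of_loc_twoScale η hloc htsd) hnum hsuf


end Summit.AtomisticToContinuum.BoseEinsteinCondensation.Theorems.BoxCountShadow
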